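import Summits.ABC.IUTFork.Joshi.TestThetaValuesLocusModel
import Summits.ABC.IUTFork.Joshi.AdelicAnsatzExponentInstance
import Mathlib.RingTheory.Polynomial.Cyclotomic.Roots
import HarnessLib

/-!
# The `ϕ^{−1}`-clause of [J-IIp] Prop. 6.6.1 («`Σ̃_F` is `ϕ`-INVARIANT») is INDEPENDENT of E-t3's typed signature:
# FALSE in E-t3's `Q̄_p`-point model, TRUE in the exponent model — so the binder «`F` perfect ∧ `ϕ` bijective on points» of the
# gluing certificate `PrototypeSupply` is not redundant (kernel, two models)

Test-side support file of the abc-iut cell, block E «type Joshi's construction, test vs S» (rung LADDER-ABC:A2.E; seat abc-iut-E-t57,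
batch-3 «[J-IIp] DERIVABLE/SUPPLIER seat»), over abc-iut-E-t3's vacuity model `Joshi/TestThetaValuesLocusModel.lean` (p432971: `Model.prototypeDatum p`,
points `Y := Q̄_p`, `ϕ(y) := y^p`) and this seat's `Joshi/PrototypeExponentModel.lean` (p434861: `ExpModel.prototypeDatum p`, points `ℚ`, `ϕ(r) := p·r`)
/ `Joshi/AdelicAnsatzExponentInstance.lean` (p435471: `ExpModel.inputs`). Nothing of either model is modified; both are read BY NAME.

THE QUESTION (raised by abc-iut-E-t7 when naming supplier row S1, STATUS 2026-08-26T07:50:30Z: «`primitiveAnsatz_frob` (forward only — the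
`↔` needs `frobY` bijective / `F` perfect: add it as the ONE extra hypothesis and say so)»). [J-IIp] (K. Joshi, arXiv:2303.01662v3, bib
`Joshi2023ATS2Local`, unrefereed) Prop. 6.6.1 p.16 l.43–64 states the Frobenius stability of Mochizuki's primitive Ansatz `Σ̃_F` for the
iterates `ϕ^n`, `n ∈ ℤ` — in particular the `ϕ^{−1}`-clause «if `(ϕ(y_1), …, ϕ(y_{ℓ⋆})) ∈ Σ̃_F` then `(y_1, …, y_{ℓ⋆}) ∈ Σ̃_F`», which is the
`←`-half of abc-iut-E-t7's `AdelicCurveDatum.PrimAnsatzFrobeniusInvariant` ([J-III] p.33 l.46–47 «`ϕ`-invariant»). E-t3's kernel theorem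
`PrototypeDatum.primitiveAnsatz_frob` is the `ϕ`-clause only. This seat's certificate supplies the `ϕ^{−1}`-clause from two BINDERS:
`perfect` («every `b ∈ F` has a `p`-th root», print: «`F = ℂ_p^♭` … perfectoid field of characteristic `p`», §2.1 p.7 l.10–14) and the
bijectivity of the point-Frobenius (E-t7's `frob0 : Y0 p ≃ Y0 p`; [FF18]: `ϕ` is an automorphism of `Y_{F,ℚ_p}`).

WHAT IS PROVED (a model exhibits (un)satisfiability, nothing more):
* §1 `PrototypeDatum.PrimAnsatzFrobeniusInverseStable` — the `ϕ^{−1}`-clause as a READING predicate over E-t3's signature (dot-extension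
  of E-t3's namespace, declared deliberately; never asserted).
* §2 In E-t3's model it FAILS (`Model.not_primAnsatzFrobeniusInverseStable`): with a primitive `p`-th root of unity `ζ ∈ Q̄_p` (exists:
  characteristic `0`, algebraically closed) the tuple `(a, ζ·a⁴)`, `a = p`, is NOT an Ansatz tuple (`ζ ≠ 1`) although its `ϕ`-image
  `(a^p, a^{4p})` is. Also `Model.not_frobY_injective`: `y ↦ y^p` is not injective on `Q̄_p` (`ζ ↦ 1`).
* §3 In the exponent model it HOLDS (`ExpModel.primAnsatzFrobeniusInverseStable`, from `ExpModel.inputs` = the certificate's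
  `primAnsatzFrobeniusInvariant` at the honest instance).
* §4 `primAnsatzFrobeniusInverseStable_independent`: hence the clause is decided NEITHER WAY by E-t3's typed [J-IIp] fields — what decides
  it in print is exactly the binder «`F` perfect ∧ `ϕ` bijective on `|Y_{F,ℚ_p}|`» («the signature does not record `char F = p`», E-t3's
  model docstring). LOCATED, not adjudicated; no defect in any file; TAKES NO SIDE on [IUTchIII] Cor. 3.12 or on any author; typed ≠
  proved ≠ endorsed; no FACT-LIST row, nothing asserted.
-/

noncomputable section

open Polynomial

namespace Summit.ABC.IUTFork.Joshi

/-! ## 1. The `ϕ^{−1}`-clause of Prop. 6.6.1 as a reading predicate over E-t3's signature -/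

namespace PrototypeDatum

variable {F B E0 : Type} [Field F] [CommRing B] [Field E0] {Y : Type} {K : Y → Type} [∀ y, Field (K y)] {G : Type}
  (P : PrototypeDatum F B E0 Y K G)

/-- **[J-IIp] Prop. 6.6.1, the `ϕ^{−1}`-clause** (p.16 l.43–64, stability of `Σ̃_F` under `ϕ^n`, `n ∈ ℤ`; = the `←`-half of abc-iut-E-t7's
`AdelicCurveDatum.PrimAnsatzFrobeniusInvariant`, [J-III] p.33 l.46–47): a tuple of points whose Frobenius-image is a primitive-Ansatz tuple
is itself a primitive-Ansatz tuple. READING predicate over E-t3's `PrototypeDatum` (dot-notation extension of E-t3's namespace, declared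
deliberately by seat E-t57); typed, never asserted — and, by §§2–3 below, NOT decided by the signature.
[claim: Joshi2023ATS2Local, status: disputed] -/
@[claim "Joshi2023ATS2Local" "disputed"]
def PrimAnsatzFrobeniusInverseStable : Prop :=
  ∀ t : Fin P.lstar → Y, (fun i => P.frobY (t i)) ∈ P.primitiveAnsatz → t ∈ P.primitiveAnsatz

end PrototypeDatum

/-! ## 2. FALSE in E-t3's `Q̄_p`-point model (`Y := Q̄_p`, `ϕ(y) := y^p`) -/

namespace Model

variable (p : ℕ) [hp : Fact p.Prime]

/-- `Q̄_p` contains a primitive `p`-th root of unity (characteristic `0`, algebraically closed: a root of the `p`-th cyclotomic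
polynomial). [folklore] -/
theorem exists_isPrimitiveRoot : ∃ ζ : PadicAlgCl p, IsPrimitiveRoot ζ p := by
  haveI : NeZero (p : PadicAlgCl p) := ⟨by exact_mod_cast hp.out.ne_zero⟩
  have hdeg : (cyclotomic p (PadicAlgCl p)).degree ≠ 0 := by
    rw [degree_cyclotomic, Nat.totient_prime hp.out]
    exact_mod_cast Nat.sub_ne_zero_of_lt hp.out.one_lt
  obtain ⟨ζ, hζ⟩ := IsAlgClosed.exists_root (cyclotomic p (PadicAlgCl p)) hdeg
  exact ⟨ζ, isRoot_cyclotomic_iff.mp hζ⟩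

/-- **The point-Frobenius of E-t3's model is NOT injective**: `ζ^p = 1 = 1^p` with `ζ ≠ 1` — so E-t7's bijective `ℚ_p`-level Frobenius
`AdelicCurveDatum.frob0` cannot be glued to it (no `PrototypeSupply` with `⇑frob0 = frobY` over this model). [folklore] -/
theorem not_frobY_injective : ¬ Function.Injective (Model.periodRingDatum p).frobY := by
  obtain ⟨ζ, hζ⟩ := exists_isPrimitiveRoot p
  intro hinj
  have h1 : (Model.periodRingDatum p).frobY ζ = (Model.periodRingDatum p).frobY 1 := by
    show ζ ^ p = (1 : PadicAlgCl p) ^ p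
    rw [hζ.pow_eq_one, one_pow]
  exact hζ.ne_one hp.out.one_lt (hinj h1)

/-- **The `ϕ^{−1}`-clause FAILS in E-t3's model**: for `a = p` and a primitive `p`-th root of unity `ζ`, the tuple `(a, ζ·a⁴)` has
`ϕ`-image `(a^p, (a^p)⁴)` — the Ansatz tuple of `a^p` — but is not an Ansatz tuple (its second entry would have to be `a⁴`, and
`ζ ≠ 1`). [folklore] -/
theorem not_primAnsatzFrobeniusInverseStable : ¬ (Model.prototypeDatum p).PrimAnsatzFrobeniusInverseStable := by
  obtain ⟨ζ, hζ⟩ := exists_isPrimitiveRoot p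
  set a : PadicAlgCl p := (p : PadicAlgCl p) with ha_def
  have ha0 : a ≠ 0 := by rw [ha_def]; exact_mod_cast hp.out.ne_zero
  -- the witness tuple `(a, ζ·a⁴)` on `Fin 2 = Fin ℓ⋆`
  let t : Fin (Model.prototypeDatum p).lstar → PadicAlgCl p := fun i => if (i : ℕ) = 0 then a else ζ * a ^ 4
  intro h
  have hmem : (fun i => (Model.prototypeDatum p).frobY (t i)) ∈ (Model.prototypeDatum p).primitiveAnsatz := by
    refine ⟨a ^ p, (Model.prototypeDatum p).pow_mem_ansatzParam ?_ hp.out.ne_zero, funext fun i => ?_⟩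
    · -- `a = p ∈ 𝔪 ∖ 0`
      refine ⟨ha0, ?_⟩
      show Model.absOne p a < 1
      rw [Model.absOne_apply, ha_def, ← map_natCast (algebraMap ℚ_[p] (PadicAlgCl p)), ← PadicAlgCl.coe_eq]
      show ‖((p : ℚ_[p]) : PadicAlgCl p)‖ < 1
      rw [PadicAlgCl.norm_extends, Padic.norm_p]
      exact inv_lt_one_of_one_lt₀ (by exact_mod_cast hp.out.one_lt)
    · show (t i) ^ p = (a ^ p) ^ (((i : ℕ) + 1) ^ 2)
      match i with
      | ⟨0, _⟩ => simp [t]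
      | ⟨1, _⟩ =>
          simp only [t, Nat.one_ne_zero, if_false]
          rw [mul_pow, hζ.pow_eq_one, one_mul, ← pow_mul, ← pow_mul]
          ring
      | ⟨n + 2, hn⟩ => exact absurd hn (by show ¬ n + 2 < 2; omega)
  obtain ⟨b, -, hb⟩ := h t hmem
  have h0 : a = b := by
    have := congrFun hb ⟨0, by show 0 < 2; norm_num⟩
    simpa [t, PrototypeDatum.ansatzPt, Model.prototypeDatum, Model.periodRingDatum] using this
  have h1 : ζ * a ^ 4 = b ^ 4 := by
    have := congrFun hb ⟨1, by show 1 < 2; norm_num⟩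
    simpa [t, PrototypeDatum.ansatzPt, Model.prototypeDatum, Model.periodRingDatum] using this
  rw [← h0] at h1
  have hζ1 : ζ = 1 := by
    have ha4 : a ^ 4 ≠ 0 := pow_ne_zero 4 ha0
    calc ζ = ζ * a ^ 4 * (a ^ 4)⁻¹ := by rw [mul_assoc, mul_inv_cancel₀ ha4, mul_one]
      _ = a ^ 4 * (a ^ 4)⁻¹ := by rw [h1]
      _ = 1 := mul_inv_cancel₀ ha4
  exact hζ.ne_one hp.out.one_lt hζ1

end Model

/-! ## 3. TRUE in the exponent model (`Y := ℚ`, `ϕ(r) := p·r`) -/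

namespace ExpModel

variable (p : ℕ) [hp : Fact p.Prime]

/-- **The `ϕ^{−1}`-clause HOLDS in the exponent model**: it is the `←`-half of `PrimAnsatzFrobeniusInvariant` at the honest instance
(`ExpModel.inputs`, p435471), i.e. the certificate's derivation from «`p`-th roots exist» + «`r ↦ p·r` is injective». [folklore] -/
theorem primAnsatzFrobeniusInverseStable : (ExpModel.prototypeDatum p).PrimAnsatzFrobeniusInverseStable :=
  fun t ht => ((ExpModel.inputs p).2.1 () t).2 ht

end ExpModel

/-! ## 4. Independence -/

/-- **INDEPENDENCE (two kernel models).** The `ϕ^{−1}`-clause of [J-IIp] Prop. 6.6.1 — the `←`-half of E-t7's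
`PrimAnsatzFrobeniusInvariant` — is FALSE in one model of E-t3's typed [J-IIp] signature (the `Q̄_p`-point model, p432971) and TRUE in
another (the exponent model, p434861): E-t3's fields decide it neither way. What decides it in print is «`F = ℂ_p^♭` is perfect» together
with the bijectivity of `ϕ` on `|Y_{F,ℚ_p}|` — precisely the binder `perfect` (+ `frobY_bijective`) of this seat's certificate
`AdelicCurveDatum.PrototypeSupply` / `PrototypeFamily` (p432358), which is therefore NOT redundant. Located, not adjudicated. [folklore] -/
theorem primAnsatzFrobeniusInverseStable_independent :
    (¬ (Model.prototypeDatum 2).PrimAnsatzFrobeniusInverseStable) ∧ (ExpModel.prototypeDatum 2).PrimAnsatzFrobeniusInverseStable :=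
  haveI : Fact (Nat.Prime 2) := ⟨Nat.prime_two⟩
  ⟨Model.not_primAnsatzFrobeniusInverseStable 2, ExpModel.primAnsatzFrobeniusInverseStable 2⟩

end Summit.ABC.IUTFork.Joshi

end
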